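import Summits.SmoothPoincare4.SmoothPoincare4.Theorems.EntropyRungChangGurskyYangStubSmoothRoundLimitDefect
import Summits.SmoothPoincare4.SmoothPoincare4.Theorems.EntropyRungChangGurskyYangStubSmoothRoundLimitWindow
import Summits.SmoothPoincare4.SmoothPoincare4.Theorems.EntropyRungChangGurskyYangStubSmoothRoundLimitDecayOne
import Summits.SmoothPoincare4.SmoothPoincare4.Theorems.EntropyRungChangGurskyYangStubSmoothRoundLimitDecayAll
import Summits.SmoothPoincare4.SmoothPoincare4.Theorems.EntropyRungChangGurskyYangStubSmoothRoundLimitChartData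
import Summits.SmoothPoincare4.SmoothPoincare4.Theorems.EntropyRungChangGurskyYangStubSmoothRoundLimitChartBounds
import Summits.SmoothPoincare4.SmoothPoincare4.Theorems.EntropyRungChangGurskyYangStubSmoothRoundLimitLimitMetric
import Summits.SmoothPoincare4.SmoothPoincare4.Theorems.EntropyRungChangGurskyYangStubSmoothRoundLimitLimitRound
import HarnessLib

/-!
# The scaled metrics `g(t)/(T−t)` of a Type-I roundening Ricci flow converge smoothly to a round metric
(stub `stub_smoothRoundLimit` of line `margerin-cone-hamilton-rails`, crux `EntropyRung.ChangGurskyYang`,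
item stmt-SmoothPoincare4-10834)

STUB 4.B5 of the line — Hamilton 1982, §14 (Lemma 14.2) and §17 (Thm. 17.6, Cor. 17.10–17.11) on the
FIXED compact 4-manifold: from the roundness rates `|(T−t)R − 2| ≤ C(T−t)^δ`, `(T−t)²|E|² ≤ C(T−t)^{2δ}`,
`(T−t)²|W|² ≤ C(T−t)^δ` and the scaled Shi bounds `|∇ᵏRm|² ≤ C_k (T−t)^{−k−2}`, a `C^∞` Riemannian
metric of constant sectional curvature `1/6` exists on `M`. This file is the sorry-free ASSEMBLY of the
landed layers:

* S2 `helper_roundDefect_evolution` — evolution inequality of the round defect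
  `P' = |Rm − (1/(6(T−t))) g⊙g|² = |Rm|² − 2R/(3(T−t)) + 2/(3(T−t)²)`:
  `∂ₜP' ≤ ΔP' − 2|∇Rm|² + C(|Rm|² + (T−t)⁻²)√P' + C|Rm|·P'` (every reaction term carries the defect);
* S3 `helper_bernsteinWindow`, `helper_curvDeriv_decay_one`, `helper_curvDeriv_decay_all` — the
  Bernstein–Shi maximum-principle induction WITH DECAY: `|∇ᵏ⁺¹Rm|² ≤ C(T−t)^{δ_k − k − 3}` for all `k`;
* S4 `helper_scaledChart_data`, `helper_scaledChart_bounds` — chart data of `g/(T−t)` (two-sided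
  bounds, decay of `Ric − g/(2(T−t))` and of the covariant Ricci derivatives) and the graded Grönwall
  with integrable coefficients: uniform `Cᵐ` bounds and the Cauchy property as `t ↑ T`;
* S5 `helper_scaledLimit_metric`, `helper_scaledLimit_round` — the smooth limit metric and its
  roundness (`Ric = g'/2`, `W = 0`, Besse 1.118).

## References

* R. S. Hamilton, *Three-manifolds with positive Ricci curvature*, J. Differential Geom. 17 (1982)
  255–306, §14, Lemma 14.2; §17, Thm. 17.6, Cor. 17.10, Cor. 17.11. [Hamilton1982]
* A. L. Besse, *Einstein manifolds*, Springer 1987, 1.118. [Besse1987]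
* P. Topping, *Lectures on the Ricci flow*, CUP 2006, Thm. 3.3.1, §5.3. [Topping2006]
-/

noncomputable section

-- every `Summit.SmoothPoincare4.SmoothPoincare4.…` name repeats the summit = sub-problem segment (D-0017 layout)
set_option linter.dupNamespace false

open Set Function Filter
open scoped Manifold ContDiff Topology

namespace Summit.SmoothPoincare4.SmoothPoincare4.Theorems.MargerinRails

open Literature.Geometry.Riemannian
open Literature.Geometry.Lorentzian Literature.Geometry.Lorentzian.PseudoRiemannianMetric

/-- **STUB 4.B5 — THE SCALED METRICS `g(t)/(T−t)` CONVERGE SMOOTHLY TO A ROUND METRIC (Hamilton 1982,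
§14, Lemma 14.2 and §17, Thm. 17.6–Cor. 17.11; Besse 1987, 1.118).** A Ricci flow of Riemannian metrics on
`[0, T)` on a closed connected 4-manifold with the roundness rate `|(T−t)R − 2| ≤ C(T−t)^δ`,
`(T−t)²|E|² ≤ C(T−t)^{2δ}`, `(T−t)²|W|² ≤ C(T−t)^δ` and scaled Shi bounds of all orders carries a
`C^∞` Riemannian metric of constant sectional curvature (`1/6`). Assembly of the layers S2–S5; the
connectedness hypothesis of the registered statement is not used. [cite: Hamilton1982, §14, Lemma 14.2; §17, Thm. 17.6, Cor. 17.10, Cor. 17.11] [cite: Besse1987, 1.118] -/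
theorem stub_smoothRoundLimit : ∀ (M : Type) [TopologicalSpace M] [T2Space M] [SecondCountableTopology M] [ChartedSpace (EuclideanSpace ℝ (Fin 4)) M] [IsManifold (𝓡 4) ∞ M] [CompactSpace M] [ConnectedSpace M] (g : ℝ → PseudoRiemannianMetric (𝓡 4) ∞ (EuclideanSpace ℝ (Fin 4)) (TangentSpace (𝓡 4) : M → Type _)) (cov : ℝ → CovariantDerivative (𝓡 4) (EuclideanSpace ℝ (Fin 4)) (TangentSpace (𝓡 4) : M → Type _)) (T : ℝ), 0 < T → IsRicciFlow g cov (Ico 0 T) → (∀ t ∈ Ico 0 T, (g t).IsRiemannian) → ∀ (δ C t₀ : ℝ), 0 < δ → t₀ ∈ Ico 0 T → (∀ t ∈ Ico t₀ T, ∀ x : M, |(T - t) * (g t).scalarCurvatureWith (cov t) x - 2| ≤ C * (T - t) ^ δ ∧ (T - t) ^ 2 * ((g t).normSq x ((cov t).ricci x) - (g t).scalarCurvatureWith (cov t) x ^ 2 / 4) ≤ C * (T - t) ^ (2 * δ) ∧ (T - t) ^ 2 * ((g t).curvNormSqWith (cov t) x - 2 * (g t).normSq x ((cov t).ricci x) +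 (g t).scalarCurvatureWith (cov t) x ^ 2 / 3) ≤ C * (T - t) ^ δ) → (∀ k : ℕ, ∃ C' t₁ : ℝ, t₁ ∈ Ico 0 T ∧ ∀ t ∈ Ico t₁ T, ∀ z : M, curvDerivNormSq (𝓡 4) g k t z ≤ C' * ((T - t) ^ (k + 2))⁻¹) → ∃ (k : ℝ) (g' : PseudoRiemannianMetric (𝓡 4) ∞ (EuclideanSpace ℝ (Fin 4)) (TangentSpace (𝓡 4) : M → Type _)), 0 < k ∧ g'.IsRiemannian ∧ g'.HasConstantSectionalCurvature k := by
  intro M _ _ _ _ _ _ _ g cov T hT hflow hRiem δ C t₀ hδ ht₀ hrate hshi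
  have hP := helper_roundDefect_evolution M g cov T hT hflow hRiem
  have hW := fun θ f F Φf ΦF hθ ↦ helper_bernsteinWindow M g T θ f F Φf ΦF hT hθ hRiem
  have h1 := helper_curvDeriv_decay_one M g cov T hT hflow hRiem δ C t₀ hδ ht₀ hrate hshi hP hW
  have hdec := helper_curvDeriv_decay_all M g cov T hT hflow hRiem δ C t₀ hδ ht₀ hrate hshi hW h1
  have hdata := helper_scaledChart_data M g cov T hT hflow hRiem δ C t₀ hδ ht₀ hrate hdec
  have hbounds := helper_scaledChart_bounds M g cov T hT hflow hRiem hdata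
  obtain ⟨g', hg', hconv⟩ := helper_scaledLimit_metric M g cov T hT hflow hRiem hbounds
  exact ⟨1 / 6, g', by norm_num, hg',
    helper_scaledLimit_round M g cov T hT hflow hRiem δ C t₀ hδ ht₀ hrate g' hg' hconv⟩

end Summit.SmoothPoincare4.SmoothPoincare4.Theorems.MargerinRails

end
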